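import Summits.BirchSwinnertonDyer.BirchSwinnertonDyer.Theorems.AlignedTransportAtTwoMainConjectureOfRankZeroBSDAtTwoSelmerLayerTwoSidedMatching
import HarnessLib

/-!
# Route `AlignedTransportAtTwo`, crux C2 `MainConjectureOfRankZeroBSDAtTwo` (stmt-BirchSwinnertonDyer-22298):
# GREENBERG'S `ker g_n` AT A SINGLE LAYER IS FINITE AS SOON AS THE LOCAL TOWER KERNELS ABOVE `p` ARE —
# so layer-`n` corank control, and the two-sided layer-one matching at `p = 2`, hold MODULO EXACTLY the finiteness of
# `𝒦_{v,n}[p^∞] = ker(H¹(K_{n,v}, E) → H¹(K_{∞,η}, E))[p^∞]` at the places `v ∣ p` (Greenberg's Lemma 3.4 at the layer `n`)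

HONEST FRAMING (cell `bsd-f1-sign2`, WIDTH-5 attached prover seat `bsd-line-att-p5` gen 40 on line `birth` of the lead
`bsd-line-att-p2`; `--supports` stmt-BirchSwinnertonDyer-22298, closes nothing; BSD is NOT proved by any of this; the crux
C2, its verdict «blocked-on `Rank1Residual.GreenbergMuConjectureIrreducible`» and every registered stub are untouched).
THEOREMS ONLY — no `def`, no instance, no named fact, no `sorry`.

The tree localises Greenberg's `ker g_n = A_n/Sel_n` either at the base layer only (`finite_kerG_zero_of_localTowerKerPrimary`,
`finite_kerG_zero_of_finite_localTowerKerPrimary_dvd`) or at all layers at once with UNIFORM bounds (`…_of_localKernelBounds`,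
Lemma 3.5). For corank control at ONE layer `n` only finiteness at that layer is needed:

* ★★ `finite_kerG_of_localTowerKerPrimary` (any number field `K`, any `ℤ_p`-extension, any `n`): if `𝒦_{v,n}[p^∞] = 0` off a finite
  `S` and is finite on `S`, then `ker g_n` is finite (Greenberg's evaluation map at the finitely many double cosets
  `D_v \\ Γ_K / Γ_n`, `ZpExtension.exists_finset_forall_eq_resGal_mul_mul`; completely split places contribute nothing);
* ★★ `finite_kerG_of_finite_localTowerKerPrimary_dvd` (`K : Type`): **`ker g_n` is finite as soon as `𝒦_{v,n}[p^∞]` is finite at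
  every `v ∣ p`** — good `v ∤ p` give `0` and bad `v ∤ p` are finite at every layer by Greenberg's Lemma 3.3
  (`finite_and_natCard_localTowerKerPrimary_le_of_not_mem`, cell `bsd-2adic`);
* ★★★ `selmerCorank_layer_eq_lambdaInvariant_layerQuotient_of_finite_localTowerKerPrimary_dvd` —
  **`corank_{ℤ_p} Sel_{p^∞}(E_{K_n}/K_n) = rank_{ℤ_p} X/ω_n X` modulo Lemma 3.4 at the layer `n` ALONE** (finiteness of
  `𝒦_{v,n}[p^∞]` at `v ∣ p`);
* ★★★ `lambdaInvariant_quotient_X_add_two_eq_selmerCorank_quadraticTwist_of_finite_localTowerKerPrimary_two` (`K = ℚ`, `p = 2`) —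
  **`rank_{ℤ₂} X/(T+2)X = corank_{ℤ₂} Sel_{2^∞}(W⁽²⁾/ℚ)` as soon as `ker(H¹(ℚ_{1,v}, E) → H¹(ℚ_{∞,η}, E))[2^∞]` is finite at the
  place `v ∣ 2`** (`ℚ_{1,v} = ℚ₂(√2)`): the lineage's two-sided layer-one matching with its ONE remaining local input displayed.

References: R. Greenberg, LNM 1716 (1999), §3 Lemmas 3.3–3.5 (pp. 86–90), Thm. 1.2 [GreenbergLNM1716]; B. Mazur, Invent. Math.
18 (1972), §6 [Mazur1972]; L. Washington, GTM 83, §13.1 [Washington1997].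
-/

set_option linter.dupNamespace false
set_option autoImplicit false

noncomputable section

open scoped Classical AddSubgroup

universe u

namespace Summit.BirchSwinnertonDyer.BirchSwinnertonDyer.Theorems.AlignedTransportAtTwoSelmerLayerControlLocal

open NumberField IsDedekindDomain WeierstrassCurve Literature.NumberTheory.EllipticCurves
  Literature.NumberTheory.GaloisRepresentations Literature.NumberTheory.EllipticCurves.Greenberg1999
  Summit.BirchSwinnertonDyer.BirchSwinnertonDyer.Theorems.AlignedTransportAtTwoSelmerLayerControl
  Summit.BirchSwinnertonDyer.BirchSwinnertonDyer.Theorems.AlignedTransportAtTwoSelmerLayerTwoSidedMatching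

/-! ## §1 Single-layer localisation -/

section Local

variable {K : Type u} [Field K] [NumberField K] (W : WeierstrassCurve K) {p : ℕ} [Fact p.Prime]
  (κ : ZpExtension K p)

/-- ★★ **`ker g_n = A_n / Sel_{p^∞}(E/K_n)` is finite at a single layer `n` as soon as the local tower kernels `𝒦_{v,n}[p^∞]`
vanish off a finite set `S` of finite places and are finite on `S`** (any number field, any `ℤ_p`-extension). Greenberg's
proof of Lemma 3.5 at one layer: discard the places of `S` that split completely in `K_∞/K` (`𝒦_{v,n} = 0` there,
`localTowerKerPrimary_eq_bot_of_forall_mem`); for the others, finitely many `ρ` with `Γ_K = ⋃ D_v ρ Γ_n`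
(`ZpExtension.exists_finset_forall_eq_resGal_mul_mul`); the evaluation map `y ↦ (loc_v (conj_ρ y))_{(v,ρ)}` on `A_n` takes values
in the finite `∏ 𝒦_{v,n}[p^∞]` and its kernel lies in `Sel_n` (`mem_selmerLayer_of_forall_localResOver_conjH1_eq_zero`).
[cite: GreenbergLNM1716, §3 Lemma 3.5 (proof, p. 90) and p. 86] -/
theorem finite_kerG_of_localTowerKerPrimary (n : ℕ) (S : Finset (HeightOneSpectrum (𝓞 K)))
    (h0 : ∀ v ∉ S, W.localTowerKerPrimary κ (v.adicCompletion K) n = ⊥)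
    (hS : ∀ v ∈ S, Finite (W.localTowerKerPrimary κ (v.adicCompletion K) n)) :
    Finite (W.KerG κ n) := by
  -- the places of `S` that do NOT split completely in `K_∞/K`, and their coset representatives at layer `n`
  let S' : Finset (HeightOneSpectrum (𝓞 K)) := S.filter fun v ↦
    ∃ δ : Field.absoluteGaloisGroup (v.adicCompletion K), resGal (K := K) (v.adicCompletion K) δ ∉ κ.kerSubgroup
  have h0' : ∀ v ∉ S', W.localTowerKerPrimary κ (v.adicCompletion K) n = ⊥ := by
    intro v hv
    by_cases hvS : v ∈ S
    · have hsplit : ∀ δ : Field.absoluteGaloisGroup (v.adicCompletion K),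
          resGal (K := K) (v.adicCompletion K) δ ∈ κ.kerSubgroup :=
        fun δ ↦ by_contra fun hδ ↦ hv (Finset.mem_filter.mpr ⟨hvS, δ, hδ⟩)
      exact W.localTowerKerPrimary_eq_bot_of_forall_mem κ (v.adicCompletion K) n hsplit
    · exact h0 v hvS
  have hR : ∀ v ∈ S', ∃ R : Finset (Field.absoluteGaloisGroup K), ∀ σ : Field.absoluteGaloisGroup K, ∃ ρ ∈ R,
      ∃ δ : Field.absoluteGaloisGroup (v.adicCompletion K), ∃ τ ∈ κ.layerSubgroup n,
        σ = resGal (K := K) (v.adicCompletion K) δ * ρ * τ := by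
    intro v hv
    obtain ⟨δ₀, hδ₀⟩ := (Finset.mem_filter.mp hv).2
    obtain ⟨N, hN⟩ := ZpExtension.exists_finset_forall_eq_resGal_mul_mul κ hδ₀
    obtain ⟨R, -, hRcov⟩ := hN n
    exact ⟨R, hRcov⟩
  choose! R hRcov using hR
  set A := W.selmerInftyPreimage κ n with hA
  -- the index set and the evaluation map
  set I : Finset ((_ : HeightOneSpectrum (𝓞 K)) × Field.absoluteGaloisGroup K) := S'.sigma fun v ↦ R v with hI
  have hIv : ∀ i : ↥I, i.1.1 ∈ S' := fun i ↦ (Finset.mem_sigma.mp i.2).1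
  let Φ : ↥A →+ (Π i : ↥I, discreteH1 (localSubgroup (κ.layerSubgroup n) (i.1.1.adicCompletion K))
      (localPoints W (i.1.1.adicCompletion K))) :=
    AddMonoidHom.pi fun i ↦
      ((W.localResOver p (κ.layerSubgroup n) (i.1.1.adicCompletion K)).comp
        (W.conjH1 p (κ.layerSubgroup n) i.1.2)).comp A.subtype
  have hΦ : ∀ (y : ↥A) (i : ↥I), Φ y i = W.localResOver p (κ.layerSubgroup n)
      (i.1.1.adicCompletion K) (W.conjH1 p (κ.layerSubgroup n) i.1.2 (y : W.subgroupH1 p _)) :=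
    fun y i ↦ rfl
  -- `ker Φ ⊆ Sel_n`
  have hker : Φ.ker ≤ (W.selmerLayer κ n).addSubgroupOf A := by
    intro y hy
    rw [AddSubgroup.mem_addSubgroupOf]
    refine W.mem_selmerLayer_of_forall_localResOver_conjH1_eq_zero κ S' h0' R (fun v hv σ ↦ hRcov v hv σ) y.2
      fun v hv ρ hρ ↦ ?_
    have := congrFun ((AddMonoidHom.mem_ker).mp hy) ⟨⟨v, ρ⟩, Finset.mem_sigma.mpr ⟨hv, hρ⟩⟩
    rw [hΦ] at this
    exact this
  -- the values of `Φ` lie in `∏ 𝒦_{v,n}[p^∞]`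
  have hval : ∀ (y : ↥A) (i : ↥I), Φ y i ∈ W.localTowerKerPrimary κ (i.1.1.adicCompletion K) n := by
    intro y i
    obtain ⟨k, hk⟩ := W.exists_pow_smul_subgroupH1_layer_eq_zero κ n (y : W.subgroupH1 p _)
    rw [hΦ]
    exact ⟨W.localResOver_conjH1_mem_localTowerKer_of_mem κ y.2 _ _, k, by
      rw [← map_nsmul, ← map_nsmul, hk, map_zero, map_zero]⟩
  -- finiteness
  haveI hfin : ∀ i : ↥I, Finite (W.localTowerKerPrimary κ (i.1.1.adicCompletion K) n) :=
    fun i ↦ hS _ (Finset.mem_filter.mp (hIv i)).1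
  let g : Φ.range → Π i : ↥I, ↥(W.localTowerKerPrimary κ (i.1.1.adicCompletion K) n) :=
    fun x i ↦ ⟨x.1 i, by obtain ⟨y, hy⟩ := x.2; rw [← hy]; exact hval y i⟩
  have hg : Function.Injective g := by
    rintro ⟨x, hx⟩ ⟨x', hx'⟩ h
    refine Subtype.ext (funext fun i ↦ ?_)
    have := congrFun h i
    simpa [g] using this
  haveI : Finite Φ.range := Finite.of_injective g hg
  haveI : Finite (↥A ⧸ Φ.ker) := Finite.of_equiv _ (QuotientAddGroup.quotientKerEquivRange Φ).toEquiv.symm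
  -- `A ⧸ ker Φ ↠ A ⧸ Sel_n`
  let π : ↥A ⧸ Φ.ker →+ ↥A ⧸ (W.selmerLayer κ n).addSubgroupOf A :=
    QuotientAddGroup.map Φ.ker ((W.selmerLayer κ n).addSubgroupOf A) (AddMonoidHom.id _)
      (by rwa [AddSubgroup.comap_id])
  have hπ : Function.Surjective π := by
    intro q
    induction q using QuotientAddGroup.induction_on with
    | H a => exact ⟨QuotientAddGroup.mk a, rfl⟩
  exact Finite.of_surjective π hπ

end Local

/-! ## §2 `ker g_n` from the places above `p` alone (Lemma 3.3 at every layer) -/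

section AboveP

variable {K : Type} [Field K] [NumberField K] (W : WeierstrassCurve K) [W.IsElliptic] {p : ℕ} [Fact p.Prime]
  (κ : ZpExtension K p) {γ : Field.absoluteGaloisGroup K}

/-- ★★ **`ker g_n` is finite as soon as `𝒦_{v,n}[p^∞]` is finite at every `v ∣ p`** (elliptic `W` over a number field
`K : Type`, any `ℤ_p`-extension, any `n`): with `S = {v ∣ p} ∪ {bad v}` (finite), the good `v ∤ p` have `𝒦_{v,n}[p^∞] = 0`
(`localTowerKerPrimary_eq_bot_of_hasGoodReductionAt`) and the bad `v ∤ p` have it finite at every layer (Greenberg's Lemma 3.3,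
`finite_and_natCard_localTowerKerPrimary_le_of_not_mem`); §1 localises. So at the single layer `n` the ONE remaining input of
corank control is Lemma 3.4 at that layer, finiteness clause. [cite: GreenbergLNM1716, §3 Lemmas 3.3–3.5 (pp. 86–90)] -/
theorem finite_kerG_of_finite_localTowerKerPrimary_dvd (n : ℕ)
    (hfin : ∀ v : HeightOneSpectrum (𝓞 K), (p : 𝓞 K) ∈ v.asIdeal →
      Finite (W.localTowerKerPrimary κ (v.adicCompletion K) n)) :
    Finite (W.KerG κ n) := by
  have hp0 : (Ideal.span {(p : 𝓞 K)} : Ideal (𝓞 K)) ≠ ⊥ := by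
    rw [Ne, Ideal.span_singleton_eq_bot]
    exact_mod_cast (Fact.out : p.Prime).ne_zero
  have hfinp : {v : HeightOneSpectrum (𝓞 K) | (p : 𝓞 K) ∈ v.asIdeal}.Finite := by
    refine (Ideal.finite_factors hp0).subset fun v hv ↦ ?_
    simp only [Set.mem_setOf_eq] at hv ⊢
    exact (Ideal.dvd_span_singleton).mpr hv
  have hbad : (W.badPlaces (𝓞 K)).Finite := W.finite_badPlaces_holds (𝓞 K)
  let S : Finset (HeightOneSpectrum (𝓞 K)) := (hfinp.union hbad).toFinset
  have hS : ∀ v : HeightOneSpectrum (𝓞 K), v ∈ S ↔ (p : 𝓞 K) ∈ v.asIdeal ∨ ¬ W.HasGoodReductionAt v := fun v ↦ by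
    simp only [S, Set.Finite.mem_toFinset, Set.mem_union, Set.mem_setOf_eq, WeierstrassCurve.mem_badPlaces_iff]
  refine finite_kerG_of_localTowerKerPrimary W κ n S (fun v hv ↦ ?_) (fun v hv ↦ ?_)
  · rw [hS, not_or, not_not] at hv
    exact localTowerKerPrimary_eq_bot_of_hasGoodReductionAt W κ hv.1 hv.2 n
  · by_cases hpv : (p : 𝓞 K) ∈ v.asIdeal
    · exact hfin v hpv
    · exact (W.finite_and_natCard_localTowerKerPrimary_le_of_not_mem κ hpv n).1

/-- ★★★ **`corank_{ℤ_p} Sel_{p^∞}(E_{K_n}/K_n) = rank_{ℤ_p} X/ω_n X` modulo Lemma 3.4 at the single layer `n`**: for `W` elliptic over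
a number field `K : Type`, any `ℤ_p`-extension `κ` with topological generator `γ`, any dual datum with `X` finitely generated: if
`𝒦_{v,n}[p^∞]` is finite at every `v ∣ p`, control in corank form holds at layer `n`
(`…SelmerLayerControl.selmerCorank_layer_eq_lambdaInvariant_layerQuotient_of_finite_kerG`).
[cite: GreenbergLNM1716, Thm 1.2 and §3 Lemma 3.4 (p. 89)] -/
theorem selmerCorank_layer_eq_lambdaInvariant_layerQuotient_of_finite_localTowerKerPrimary_dvd
    (hγ : κ.IsTopGenerator γ) (D : W.SelmerDualData κ γ) [Module.Finite (IwasawaAlgebra p) D.X] (n : ℕ)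
    (hfin : ∀ v : HeightOneSpectrum (𝓞 K), (p : 𝓞 K) ∈ v.asIdeal →
      Finite (W.localTowerKerPrimary κ (v.adicCompletion K) n)) :
    (W.baseChange (κ.layer n)).selmerCorank p =
      lambdaInvariant p (D.X ⧸ (Ideal.span {((1 + PowerSeries.X : PowerSeries ℤ_[p]) ^ (p ^ n) - 1 : IwasawaAlgebra p)} •
        ⊤ : Submodule (IwasawaAlgebra p) D.X)) := by
  haveI := finite_kerG_of_finite_localTowerKerPrimary_dvd W κ n hfin
  exact selmerCorank_layer_eq_lambdaInvariant_layerQuotient_of_finite_kerG W κ hγ D n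

end AboveP

/-! ## §3 `p = 2`, `K = ℚ`: the two-sided layer-one matching with its one local input displayed -/

section Two

variable (W : WeierstrassCurve ℚ) [W.IsElliptic] [W.IsGloballyMinimal] {κ : ZpExtension ℚ 2}
  {γ : Field.absoluteGaloisGroup ℚ}

/-- ★★★ **`rank_{ℤ₂} X/(T+2)X = corank_{ℤ₂} Sel_{2^∞}(W⁽²⁾/ℚ)` as soon as
`𝒦_{v,1}[2^∞] = ker(H¹(ℚ_{1,v}, E) → H¹(ℚ_{∞,η}, E))[2^∞]` is finite at the place `v ∣ 2`** (`W/ℚ` globally minimal, good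
ordinary at `2`, `κ` the cyclotomic `ℤ₂`-extension with topological generator `γ`; `ℚ_{1,v} = ℚ₂(√2)`): the lineage's two-sided
layer-one matching (`…SelmerLayerTwoSidedMatching`) with the layer-1 cokernel discharged down to Greenberg's Lemma 3.4 at `n = 1`,
finiteness clause — the ONE input not in the tree. The unconditional half `≤` is
`selmerCorank_quadraticTwist_le_lambdaInvariant_quotient_X_add_two`. [cite: GreenbergLNM1716, Thm 1.2, §3 Lemmas 3.3–3.5]
[cite: DokchitserDokchitserAnnals2010, Lemma 4.14] -/
theorem lambdaInvariant_quotient_X_add_two_eq_selmerCorank_quadraticTwist_of_finite_localTowerKerPrimary_two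
    (h2 : IsOrdinaryAt W 2) (hκ : κ.IsCyclotomic) (hγ : κ.IsTopGenerator γ) (D : W.SelmerDualData κ γ)
    (hfin : ∀ v : HeightOneSpectrum (𝓞 ℚ), (2 : 𝓞 ℚ) ∈ v.asIdeal →
      Finite (W.localTowerKerPrimary κ (v.adicCompletion ℚ) 1)) :
    lambdaInvariant 2 (D.X ⧸ (Ideal.span {(PowerSeries.X + 2 : IwasawaAlgebra 2)} • ⊤ : Submodule (IwasawaAlgebra 2) D.X)) =
      (W.quadraticTwist 2).selmerCorank 2 := by
  haveI := finite_kerG_of_finite_localTowerKerPrimary_dvd W κ 1 (fun v hv ↦ hfin v (by exact_mod_cast hv))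
  exact lambdaInvariant_quotient_X_add_two_eq_selmerCorank_quadraticTwist_of_finite_kerG W h2 hκ hγ D

end Two

end Summit.BirchSwinnertonDyer.BirchSwinnertonDyer.Theorems.AlignedTransportAtTwoSelmerLayerControlLocal

end
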